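import Literature.Topology.FourManifolds.HomotopySpheresInverse
import Literature.Topology.FourManifolds.DiscFilling
import Literature.AlgebraicTopology.Homotopy.CollaredHomotopyEquivalence
import Mathlib.Analysis.Convex.Contractible
import HarnessLib

/-!
# Inverses in `Θₙ`: Kervaire–Milnor's Lemma 2.3, direction `⇒`, discharged

Topic `Literature/Topology/FourManifolds`, sibling proofs file of `HomotopySpheresInverse.lean`.
That file vendors the direction `⇒` of Kervaire–Milnor's Lemma 2.3 (*Groups of homotopy spheres
I*, Ann. of Math. 77 (1963), p. 506) as the named fact
`Literature.Topology.FourManifolds.boundsContractible_of_isHCobordant_sphere`: *a closed simply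
connected smooth `n`-manifold `M`, `n ≥ 2`, which is h-cobordant to `𝕊ⁿ` bounds a contractible
manifold.* Printed proof (p. 506): "If `M + (-Sⁿ) = bW` then filling in a disk `Dⁿ⁺¹` we obtain a
manifold `W'` with `bW' = M`. If `Sⁿ` is a deformation retract of `W`, then it clearly follows that
`W'` is contractible." This file **proves** the fact
(`boundsContractible_of_isHCobordant_sphere_holds`), from

* the smooth half — `DiscFilling.lean`: for a cobordism `(W; M, 𝕊ⁿ)` the capped manifold
  `V = W ∪_{𝕊ⁿ} 𝔻ⁿ⁺¹` is a null-cobordism `M = ∂V` (`FillingData.nullCobordism`), and `V` is the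
  union of the closed disc `inrE (𝔻ⁿ⁺¹)` and of a copy `embW (W)` of `W` meeting along the sphere
  `inrE (𝕊ⁿ) = embW (inr 𝕊ⁿ)`;
* the homotopy half — `Literature/AlgebraicTopology/Homotopy/CollaredHomotopyEquivalence.lean`: a
  space covered by two closed pieces, one contractible and the other homotopy equivalent to their
  collared intersection through the inclusion, is contractible (Hatcher, *Algebraic Topology*
  (2002), Cor. 0.20 with Example 0.15 — the bridge between the tree's notion of h-cobordism, "the
  inclusions of the ends are homotopy equivalences" (Milnor 1965, §1), and Kervaire–Milnor's "both
  ends are deformation retracts of `W`" (§1, p. 505)).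

The collar of the seam sphere is taken on the disc side, `(a, s) ↦ inrE ((1 + s) a)`
(`FillingData.cover`), so no smoothness enters the homotopy theory; the homotopy equivalence
`𝕊ⁿ ≃ₕ embW (W)` is the h-cobordism hypothesis transported along the homeomorphism
`embW : W ≅ V ∖ inrE (B̊)` (`FillingData.homeomorphRight`). The hypotheses `n ≥ 2` and "`M` simply
connected" of the fact are not used in this direction (they are those of the printed lemma, an
`iff`); neither is the homotopy equivalence of the `M`-end.

## References

* M. Kervaire, J. Milnor, *Groups of homotopy spheres I*, Ann. of Math. (2) 77 (1963), 504–537: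
  §1 (p. 505), Lemma 2.3 and its proof (p. 506). doi:10.2307/1970128 [KervaireMilnorAnnals1963]
* A. Hatcher, *Algebraic Topology*, CUP (2002), Ch. 0, Example 0.15, Cor. 0.20. [HatcherAT2002]
* J. Milnor, *Lectures on the h-cobordism theorem*, Princeton (1965), §1. [MilnorHCobordism1965]
-/

open scoped Manifold ContDiff Topology unitInterval
open Set Function Metric
open Literature.AlgebraicTopology.Homotopy

noncomputable section

namespace Literature.Topology.FourManifolds

/-- Local notation: `𝔼 n` is the model Euclidean space `EuclideanSpace ℝ (Fin n)`. -/
local notation "𝔼 " n:arg => EuclideanSpace ℝ (Fin n)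
/-- Local notation: `𝕊 n` is the unit sphere in `EuclideanSpace ℝ (Fin (n + 1))`. -/
local notation "𝕊 " n:arg => (Metric.sphere (0 : EuclideanSpace ℝ (Fin (n + 1))) 1)

namespace FillingData

variable {n : ℕ} {M : Type} [TopologicalSpace M] [ChartedSpace (𝔼 n) M] (F : FillingData n M)
  [CompactSpace M]

/-! ### The collared cover `V = 𝔻ⁿ⁺¹ ∪ W` -/

/-- The vector `(1 + s) a` of the disc-side collar of the seam sphere. [folklore] -/
def coverVec (q : (𝕊 n) × I) : 𝔼 (n + 1) := (1 + (q.2 : ℝ)) • (q.1 : 𝔼 (n + 1))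

/-- `‖(1 + s) a‖ = 1 + s`. [folklore] -/
theorem norm_coverVec (q : (𝕊 n) × I) : ‖coverVec q‖ = 1 + (q.2 : ℝ) := by
  have h : 0 ≤ 1 + (q.2 : ℝ) := by linarith [q.2.2.1]
  rw [coverVec, norm_smul, Real.norm_eq_abs, abs_of_nonneg h, norm_eq_of_mem_sphere, mul_one]

/-- `coverVec` is continuous. [folklore] -/
theorem continuous_coverVec : Continuous (coverVec : (𝕊 n) × I → 𝔼 (n + 1)) :=
  (continuous_const.add (continuous_subtype_val.comp continuous_snd)).smul
    (continuous_subtype_val.comp continuous_fst)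

/-- `coverVec` is injective (the norm recovers `s`, then `a`). [folklore] -/
theorem injective_coverVec : Injective (coverVec : (𝕊 n) × I → 𝔼 (n + 1)) := by
  rintro ⟨a, s⟩ ⟨a', s'⟩ h
  have hs : (s : ℝ) = s' := by
    have := congrArg norm h
    rw [norm_coverVec, norm_coverVec] at this
    linarith
  have hpos : (0 : ℝ) < 1 + s := by linarith [s.2.1]
  have ha : (a : 𝔼 (n + 1)) = a' := by
    simp only [coverVec, hs] at h
    rw [← hs] at h
    exact smul_right_injective _ hpos.ne' h
  rw [Prod.mk.injEq]
  exact ⟨Subtype.ext ha, Subtype.ext hs⟩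

/-- **The disc-side collar of the seam sphere**: `(a, s) ↦ inrE ((1 + s) a)`. [folklore] -/
def coverCollar (q : (𝕊 n) × I) : F.V := F.inrE (coverVec q)

/-- The collar is continuous. [folklore] -/
theorem continuous_coverCollar : Continuous F.coverCollar :=
  F.continuous_inrE.comp continuous_coverVec

/-- The collar is injective. [folklore] -/
theorem injective_coverCollar : Injective F.coverCollar :=
  F.injective_inrE.comp injective_coverVec

/-- The bottom of the collar is the unit sphere of the second piece: `coverCollar (a, 0) = inrE a`.
[folklore] -/
@[simp] theorem coverCollar_zero (a : 𝕊 n) : F.coverCollar (a, 0) = F.inrE a := by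
  simp [coverCollar, coverVec]

/-- The open part of the collar is the shell `inrE ({1 ≤ ‖x‖ < 2})`. [folklore] -/
theorem image_coverCollar_lt :
    F.coverCollar '' {q : (𝕊 n) × I | q.2 < 1} = F.inrE '' {x | 1 ≤ ‖x‖ ∧ ‖x‖ < 2} := by
  ext p
  constructor
  · rintro ⟨q, hq, rfl⟩
    refine ⟨coverVec q, ⟨?_, ?_⟩, rfl⟩
    · rw [norm_coverVec]; linarith [q.2.2.1]
    · rw [norm_coverVec]
      have : (q.2 : ℝ) < 1 := hq
      linarith
  · rintro ⟨x, ⟨h1, h2⟩, rfl⟩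
    have hx0 : x ≠ 0 := DiscFilling.ne_zero_of_one_le_norm h1
    refine ⟨(RotationBody.sphN x, ⟨‖x‖ - 1, by linarith, by linarith⟩), ?_, ?_⟩
    · show (⟨‖x‖ - 1, _⟩ : I) < 1
      exact Subtype.mk_lt_mk.2 (by linarith)
    · show F.inrE ((1 + (‖x‖ - 1)) • (RotationBody.sphN x : 𝔼 (n + 1))) = F.inrE x
      rw [add_sub_cancel, RotationBody.norm_smul_coe_sphN hx0]

/-- **The collared cover of `V`**: the closed disc `inrE (𝔻ⁿ⁺¹)` and the complement of the open disc
(a copy of `W`, `FillingData.range_embW`), meeting along the seam sphere `inrE (𝕊ⁿ)`, which is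
collared on the disc side by `(a, s) ↦ inrE ((1 + s) a)`. [folklore] -/
def cover : CollaredCover F.V (𝕊 n) where
  left := F.inrE '' closedBall (0 : 𝔼 (n + 1)) 1
  right := (F.inrE '' ball (0 : 𝔼 (n + 1)) 1)ᶜ
  isClosed_left := ((isCompact_closedBall _ _).image F.continuous_inrE).isClosed
  isClosed_right := (F.isOpenEmbedding_inrE.isOpenMap _ isOpen_ball).isClosed_compl
  union_eq := by
    refine eq_univ_of_forall fun p => ?_
    by_cases hp : p ∈ F.inrE '' ball (0 : 𝔼 (n + 1)) 1
    · obtain ⟨x, hx, rfl⟩ := hp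
      exact Or.inl ⟨x, ball_subset_closedBall hx, rfl⟩
    · exact Or.inr hp
  collar := F.coverCollar
  isClosedEmbedding_collar := F.continuous_coverCollar.isClosedEmbedding F.injective_coverCollar
  collar_mem_right q := by
    show F.inrE (coverVec q) ∉ F.inrE '' ball (0 : 𝔼 (n + 1)) 1
    rw [F.inrE_mem_image_iff, mem_ball_zero_iff, norm_coverVec, not_lt]
    linarith [q.2.2.1]
  collar_zero_mem_left a := ⟨a, by simp, by rw [coverCollar_zero]⟩
  exists_collar_zero_eq := by
    rintro p ⟨⟨x, hx, rfl⟩, hp⟩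
    have h1 : ¬ ‖x‖ < 1 := fun h => hp ⟨x, mem_ball_zero_iff.2 h, rfl⟩
    have hx1 : ‖x‖ = 1 := le_antisymm (mem_closedBall_zero_iff.1 hx) (not_lt.1 h1)
    exact ⟨⟨x, mem_sphere_zero_iff_norm.2 hx1⟩, by rw [coverCollar_zero]⟩
  isClosed_right_diff := by
    have h : (F.inrE '' ball (0 : 𝔼 (n + 1)) 1)ᶜ \ F.coverCollar '' {q : (𝕊 n) × I | q.2 < 1} =
        (F.inrE '' ball (0 : 𝔼 (n + 1)) 2)ᶜ := by
      rw [F.image_coverCollar_lt]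
      ext p
      constructor
      · rintro ⟨h1, h2⟩ ⟨x, hx, rfl⟩
        have h1' := h1
        rw [mem_compl_iff, F.inrE_mem_image_iff, mem_ball_zero_iff, not_lt] at h1'
        exact h2 ⟨x, ⟨h1', mem_ball_zero_iff.1 hx⟩, rfl⟩
      · intro hp
        refine ⟨fun ⟨x, hx, hxp⟩ => hp ⟨x, ?_, hxp⟩, fun ⟨x, hx, hxp⟩ => hp ⟨x, ?_, hxp⟩⟩
        · exact mem_ball_zero_iff.2 (lt_trans (mem_ball_zero_iff.1 hx) (by norm_num))
        · exact mem_ball_zero_iff.2 hx.2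
    rw [h]
    exact (F.isOpenEmbedding_inrE.isOpenMap _ isOpen_ball).isClosed_compl

/-- The left piece of the cover is the closed disc (definitional). [folklore] -/
theorem cover_left : F.cover.left = F.inrE '' closedBall (0 : 𝔼 (n + 1)) 1 := rfl

/-- The right piece of the cover is the complement of the open disc (definitional). [folklore] -/
theorem cover_right : F.cover.right = (F.inrE '' ball (0 : 𝔼 (n + 1)) 1)ᶜ := rfl

/-- The inclusion of the seam is the unit sphere of the second piece. [folklore] -/
theorem coe_cover_incl (a : 𝕊 n) : (F.cover.incl a : F.V) = F.inrE a := by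
  rw [CollaredCover.coe_incl]
  exact F.coverCollar_zero a

/-- **The disc is contractible**: the left piece is homeomorphic to the convex closed unit ball.
[folklore] -/
theorem contractibleSpace_cover_left : ContractibleSpace F.cover.left := by
  haveI : ContractibleSpace (closedBall (0 : 𝔼 (n + 1)) 1) :=
    (convex_closedBall (0 : 𝔼 (n + 1)) 1).contractibleSpace ⟨0, mem_closedBall_self zero_le_one⟩
  have hemb : Topology.IsEmbedding (F.inrE ∘ (Subtype.val : closedBall (0 : 𝔼 (n + 1)) 1 → 𝔼 (n + 1))) :=
    F.isOpenEmbedding_inrE.isEmbedding.comp Topology.IsEmbedding.subtypeVal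
  have hr : range (F.inrE ∘ (Subtype.val : closedBall (0 : 𝔼 (n + 1)) 1 → 𝔼 (n + 1))) = F.cover.left := by
    rw [range_comp, Subtype.range_coe]; rfl
  exact (hemb.toHomeomorph.trans (Homeomorph.setCongr hr)).symm.contractibleSpace

/-- **`W ≅ V ∖ inrE (B̊)`**: the embedding `embW` as a homeomorphism onto the right piece of the
cover. [folklore] -/
def homeomorphRight : F.cob.W ≃ₜ F.cover.right :=
  F.isClosedEmbedding_embW.isEmbedding.toHomeomorph.trans (Homeomorph.setCongr F.range_embW)

/-- `homeomorphRight` is `embW` on underlying points. [folklore] -/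
@[simp] theorem coe_homeomorphRight (w : F.cob.W) : (F.homeomorphRight w : F.V) = F.embW w := rfl

/-- **`V = W ∪_{𝕊ⁿ} 𝔻ⁿ⁺¹` is contractible when the sphere end of `W` is a homotopy equivalence**
("If `Sⁿ` is a deformation retract of `W`, then it clearly follows that `W'` is contractible",
Kervaire–Milnor 1963, proof of Lemma 2.3, p. 506; here from the homotopy equivalence via the collar,
Hatcher Cor. 0.20). [cite: KervaireMilnorAnnals1963, Lemma 2.3, proof (p. 506)] -/
theorem contractibleSpace_V (h : IsHomotopyEquiv F.cob.inr) : ContractibleSpace F.V := by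
  obtain ⟨e₀, he₀⟩ := h
  refine F.cover.contractibleSpace_of_homotopyEquiv (e₀.trans F.homeomorphRight.toHomotopyEquiv)
    (fun a => Subtype.ext ?_) F.contractibleSpace_cover_left
  show (F.homeomorphRight (e₀.toFun a) : F.V) = (F.cover.incl a : F.V)
  rw [coe_homeomorphRight, show e₀.toFun a = F.cob.inr a from congrFun he₀ a, embW_inr,
    coe_cover_incl]

end FillingData

/-! ### The discharge -/

/-- **Kervaire–Milnor's Lemma 2.3, direction `⇒`, holds** (*Groups of homotopy spheres I*, Ann.
of Math. 77 (1963), Lemma 2.3, p. 506): a closed smooth `n`-manifold `M` h-cobordant to `𝕊ⁿ` bounds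
a contractible manifold. Proof as printed: for an h-cobordism `(W; M, 𝕊ⁿ)`, "filling in a disk
`Dⁿ⁺¹` we obtain a manifold `W'` with `bW' = M`" (`FillingData.nullCobordism`, `DiscFilling.lean`),
and `W' = W ∪_{𝕊ⁿ} 𝔻ⁿ⁺¹` is contractible because `𝕊ⁿ ↪ W` is a homotopy equivalence and `𝕊ⁿ` is
collared (`FillingData.contractibleSpace_V`; Kervaire–Milnor phrase the hypothesis as "`Sⁿ` is a
deformation retract of `W`", which for the collared boundary is equivalent, Hatcher Cor. 0.20).
The hypotheses `n ≥ 2` and simple connectivity of the fact are not needed in this direction.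
[cite: KervaireMilnorAnnals1963, Lemma 2.3 (p. 506), direction ⇒] -/
theorem boundsContractible_of_isHCobordant_sphere_holds :
    boundsContractible_of_isHCobordant_sphere := by
  intro n M _ _ _ _ _ _ _ _ hH
  obtain ⟨d, -, hinr⟩ := hH
  obtain ⟨F, rfl⟩ := exists_fillingData d
  exact ⟨F.nullCobordism, F.contractibleSpace_V hinr⟩

/-- **Kervaire–Milnor's Lemma 2.3 as printed, GIVEN only the direction `⇐`**: with the direction
`⇒` now a theorem, the `iff` of `isHCobordant_sphere_iff_boundsContractible_of` needs only the named
fact `isHCobordant_sphere_of_boundsContractible`. [cite: KervaireMilnorAnnals1963, Lemma 2.3 (p. 506)] -/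
theorem isHCobordant_sphere_iff_boundsContractible_of'
    (h : isHCobordant_sphere_of_boundsContractible) (n : ℕ) (M : Type) [TopologicalSpace M]
    [T2Space M] [SecondCountableTopology M] [ChartedSpace (𝔼 n) M] [IsManifold (𝓡 n) ∞ M]
    [CompactSpace M] [SimplyConnectedSpace M] (hn : 2 ≤ n) :
    IsHCobordant n M (𝕊 n) ↔ BoundsContractible n M :=
  isHCobordant_sphere_iff_boundsContractible_of h boundsContractible_of_isHCobordant_sphere_holds
    n M hn

end Literature.Topology.FourManifolds
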